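import Summits.BirchSwinnertonDyer.BirchSwinnertonDyer.Theorems.ThetaPartnerAtTwoSignedKatoUpToAtTwoPointsFunctional
import HarnessLib

/-!
# Route `ThetaPartnerAtTwo` (TP2), crux K3 `SignedKatoDivisibilityUpToAtTwo` (item stmt-BirchSwinnertonDyer-20308),
# line `colemanrat` v4 — THE LOCAL COVER, HARD HALF, IN THE POINTS MODEL: **every character of `Sel^ε(E/K_∞)` that
# kills the classes locally trivial at `𝔭` is the Kummer-value character of a `ℤ_p`-valued functional on the local
# tower points `E(K_∞·K_v)`** — so `range j ⊇ {x ∈ X^ε | D.toDual x kills Sel^ε ∩ ker res_𝔭}` for the width seat's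
# points-model `j` (the easy inclusion `⊆` is `KummerPoint.toDual_pointsModelJ_eq_zero_of_resOfLe_eq_zero`).

Lead `bsd-wall-tp2-p2x` g4 (cell `bsd-wall`). HONEST FRAMING: THEOREMS ONLY — no definition, no named fact, no instance, no
`sorry`; route-independent; CONVENTION-FREE (one side of Poitou–Tate only, cf. `Cruxes/…/G4-CONVENTION-AUDIT.md`);
closes no item; BSD is NOT proved by any of this.

## What is proved

* §1 `resOfLe_eq_zero_of_torsion_kummerWitness` — a torsion Kummer witness forces `res_{Gal(K̄/K_∞) ⊓ D_v} = 0` (converse of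
  `KummerPoint.exists_torsion_kummerWitness_of_resOfLe_eq_zero`); `exists_functional_of_localCover` — on a pinned
  `D : SignedSelmerDualData W κ γ ε` at a place `v ∋ p` (number field `K`; no (NT) / reduction hypothesis): every `x ∈ D.X` whose
  character kills `Sel^ε ∩ ker res_{Gal(K̄/K_∞) ⊓ D_v}` is the Kummer-value character of a functional `z` on `E(K_∞·K_v)` read on
  `A^ε = ⨆ₙ E^ε(K_n·K_v)` (`…PointsFunctional.exists_functional_of_kummerCharacter` with `S = Sel^ε_∞`, `χ = D.toDual x`);
  `exists_pointsModelJ_comp_eq_of_localCover` — hence `x = j (z|_{A^ε})` for EVERY `j` with the value formula of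
  `KummerPoint.exists_pointsModelJ`.
* §2 the `p = 2` spelling `exists_pointsModelJ_comp_eq_of_localCover_two`. This is the (LocCover) clause of K3's registered stub
  `stub_localRobustPackageTwo` for the points model `P = Hom(E(ℚ_{2,∞}), ℤ₂) (⧸ Ker Col♭)` with exponent `m = 0`.

References: [Kobayashi2003] §2 p. 4 (Kummer map), (7.17) (p. 12); [GreenbergLNM1716] §2; [SerreGaloisCohomology1997] I §5.1.
-/

set_option autoImplicit false
-- the Theorems namespace of this sub repeats the summit name by design (D-0017 nested layout)
set_option linter.dupNamespace false

noncomputable section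

open scoped Classical

namespace Summit.BirchSwinnertonDyer.BirchSwinnertonDyer.Theorems

namespace SignedKatoOffTwo.KummerPoint

open NumberField IsDedekindDomain Field WeierstrassCurve
  Literature.NumberTheory.EllipticCurves Literature.NumberTheory.EllipticCurves.Kobayashi2003
  Literature.NumberTheory.EllipticCurves.GreenbergSelmer
  Literature.NumberTheory.EllipticCurves.Sprung2012 Literature.NumberTheory.GaloisRepresentations ZpExtension

universe u

/-! ## §1 On a pinned dual at a place `v ∋ p`: the hard half of the local cover -/

section Cover

variable {K : Type u} [Field K] [NumberField K] (W : WeierstrassCurve K) [W.IsElliptic] (p : ℕ) [Fact p.Prime]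
  (κ : ZpExtension K p) {γ : absoluteGaloisGroup K} (ε : ℤˣ)

omit [W.IsElliptic] in
/-- `A^ε = ⨆ₙ E^ε(K_n·K_v)` lies in the tower points `E(K_∞·K_v)`. [cite: Kobayashi2003, Def. 1.1] -/
theorem iSup_signedLocalPoints_le_localTowerPointsOfEmb (v : HeightOneSpectrum (𝓞 K)) :
    (⨆ n, signedLocalPoints κ (v.adicCompletion K) W ε n) ≤
      localTowerPointsOfEmb κ (closureEmb (K := K) (v.adicCompletion K)) W :=
  iSup_le fun n ↦ (signedLocalPointsOfEmb_le κ _ W ε n).trans (localLayerPointsOfEmb_le_localTowerPointsOfEmb κ _ W n)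

omit [W.IsElliptic] in
/-- **A torsion Kummer witness forces local triviality at `𝔭`**: if `ι(φ τ) = τ•ι(t) − ι(t)` on `Gal(K̄_v/K_∞·K_v)` for a torsion point
`t ∈ E[p^∞](K̄)`, then `res_{Gal(K̄/K_∞) ⊓ D_v} [φ] = 0` (converse of `exists_torsion_kummerWitness_of_resOfLe_eq_zero`: `D_v` is the
image of `Γ_{K_v}`, `ι_*` is injective and equivariant). [cite: Kobayashi2003, §2 p. 4] [cite: SerreGaloisCohomology1997, I §5.1] -/
theorem resOfLe_eq_zero_of_torsion_kummerWitness (v : HeightOneSpectrum (𝓞 K))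
    (φ : contOneCocycles (discreteTopRep κ.kerSubgroup (W.geomPrimaryTorsion p))) (t : W.geomPrimaryTorsion p)
    (hτ : ∀ τ : localSubgroupOfEmb κ.kerSubgroup (closureEmb (K := K) (v.adicCompletion K)),
      pointsMapOfEmb W (closureEmb (K := K) (v.adicCompletion K))
          ((φ.1 (resGalSubgroupOfEmb κ.kerSubgroup _ τ) : W.geomPrimaryTorsion p) : W.geomPoints) =
        (τ : absoluteGaloisGroup (v.adicCompletion K)) •
            pointsMapOfEmb W (closureEmb (K := K) (v.adicCompletion K)) (t : W.geomPoints) -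
          pointsMapOfEmb W (closureEmb (K := K) (v.adicCompletion K)) (t : W.geomPoints)) :
    Literature.NumberTheory.EllipticCurves.resOfLe (W.geomPrimaryTorsion p)
      (inf_le_left : κ.kerSubgroup ⊓ decomp v ≤ κ.kerSubgroup) (oneCocycleClass _ φ) = 0 := by
  set ι := closureEmb (K := K) (v.adicCompletion K) with hι
  rw [Literature.NumberTheory.EllipticCurves.resOfLe]
  refine resH1Hom_oneCocycleClass_eq_zero_of_principal _ _ _ φ (x := t) fun g ↦ ?_
  obtain ⟨σ, hσ⟩ : ∃ σ : absoluteGaloisGroup (v.adicCompletion K), resGalOfEmb ι σ = (g : absoluteGaloisGroup K) :=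
    (Subgroup.mem_inf.1 g.2).2
  have hσmem : σ ∈ localSubgroupOfEmb κ.kerSubgroup ι := by
    rw [mem_localSubgroupOfEmb_iff, hσ]; exact (Subgroup.mem_inf.1 g.2).1
  have h1 := hτ ⟨σ, hσmem⟩
  rw [← pointsMapOfEmb_smul, ← map_sub] at h1
  have h2 : ((φ.1 (resGalSubgroupOfEmb κ.kerSubgroup ι ⟨σ, hσmem⟩) : W.geomPrimaryTorsion p) : W.geomPoints) =
      ((resGalOfEmb ι σ • t - t : W.geomPrimaryTorsion p) : W.geomPoints) := by
    rw [pointsMapOfEmb_injective W ι h1, AddSubgroupClass.coe_sub, primaryComponent.coe_smul]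
  have h3 : (φ.1 (resGalSubgroupOfEmb κ.kerSubgroup ι ⟨σ, hσmem⟩) : W.geomPrimaryTorsion p) = resGalOfEmb ι σ • t - t :=
    Subtype.ext h2
  have h4 : resGalSubgroupOfEmb κ.kerSubgroup ι ⟨σ, hσmem⟩ = subgroupInclusion (inf_le_left (b := decomp v)) g :=
    Subtype.ext hσ
  rw [← h4, h3, Subgroup.smul_def]
  rfl

/-- **The hard half of the local cover, points model.** `K` a number field, `v ∋ p`, (NT) no `p`-torsion in `E(K_∞·K_v)`, `D` ANY pinned
`SignedSelmerDualData W κ γ ε`: every `x ∈ X^ε = D.X` whose character kills the classes of `Sel^ε(E/K_∞)` that are locally trivial at `𝔭`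
(`res_{Gal(K̄/K_∞) ⊓ D_v} s = 0`) is the Kummer-value character of a functional `z : E(K_∞·K_v) →+ ℤ_p`:
`D.toDual x s = (z(p^k Q) mod p^k) • (1/p^k)` for every `s ∈ Sel^ε_∞` and every Kummer witness `(φ, Q, k)` of `s` relative to
`A^ε = ⨆ₙ E^ε(K_n·K_v)`. No (NT) / reduction hypothesis is needed in this direction.
[cite: Kobayashi2003, §2 p. 4, (7.17) (p. 12)] [cite: GreenbergLNM1716, §2] -/
theorem exists_functional_of_localCover (v : HeightOneSpectrum (𝓞 K)) (D : SignedSelmerDualData W κ γ ε) (x : D.X)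
    (hx : ∀ (s : W.subgroupH1 p κ.kerSubgroup) (hs : s ∈ signedSelmerInfty W κ ε),
      Literature.NumberTheory.EllipticCurves.resOfLe (W.geomPrimaryTorsion p)
        (inf_le_left : κ.kerSubgroup ⊓ decomp v ≤ κ.kerSubgroup) s = 0 → D.toDual x ⟨s, hs⟩ = 0) :
    ∃ z : localTowerPointsOfEmb κ (closureEmb (K := K) (v.adicCompletion K)) W →+ ℤ_[p],
      ∀ (s : W.subgroupH1 p κ.kerSubgroup) (hs : s ∈ signedSelmerInfty W κ ε)
        (φ : contOneCocycles (discreteTopRep κ.kerSubgroup (W.geomPrimaryTorsion p)))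
        (Q : localPoints W (v.adicCompletion K)) (k : ℕ)
        (_ : oneCocycleClass _ φ = s) (hQ : p ^ k • Q ∈ (⨆ n, signedLocalPoints κ (v.adicCompletion K) W ε n))
        (_ : ∀ τ : localSubgroupOfEmb κ.kerSubgroup (closureEmb (K := K) (v.adicCompletion K)),
          pointsMapOfEmb W (closureEmb (K := K) (v.adicCompletion K))
              ((φ.1 (resGalSubgroupOfEmb κ.kerSubgroup _ τ) : W.geomPrimaryTorsion p) : W.geomPoints) =
            (τ : absoluteGaloisGroup (v.adicCompletion K)) • Q - Q),
        D.toDual x ⟨s, hs⟩ =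
          (PadicInt.toZModPow k (z ⟨p ^ k • Q, iSup_signedLocalPoints_le_localTowerPointsOfEmb W p κ ε v hQ⟩)).val •
            ((((p : ℚ) ^ k)⁻¹ : ℚ) : AddCircle (1 : ℚ)) := by
  obtain ⟨z, hz⟩ := exists_functional_of_kummerCharacter W p κ (closureEmb (K := K) (v.adicCompletion K))
    (⨆ n, signedLocalPoints κ (v.adicCompletion K) W ε n) (iSup_signedLocalPoints_le_localTowerPointsOfEmb W p κ ε v)
    (signedSelmerInfty W κ ε) (D.toDual x)
    (fun c φ t hφ hτ ↦ by
      have h0 := resOfLe_eq_zero_of_torsion_kummerWitness W p κ v φ t hτ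
      rw [hφ] at h0
      simpa using hx c c.2 h0)
  exact ⟨z, fun s hs φ Q k hφ hQ hτ ↦ hz ⟨s, hs⟩ φ Q k hφ hQ hτ⟩

/-- **`range j ⊇` the local part**: for EVERY additive `j : Hom(A^ε, ℤ_p) → D.X` with the value formula of `exists_pointsModelJ`, every
`x ∈ D.X` whose character kills `Sel^ε ∩ ker res_𝔭` is `j (z|_{A^ε})` for a functional `z` on the tower points — with
`toDual_pointsModelJ_eq_zero_of_resOfLe_eq_zero`: `range j = {x | D.toDual x kills Sel^ε ∩ ker res_𝔭}` EXACTLY. This is the (LocCover)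
clause of K3's `stub_localRobustPackageTwo` in the points model, exponent `m = 0`. [cite: Kobayashi2003, (7.17) (p. 12)] -/
theorem exists_pointsModelJ_comp_eq_of_localCover (v : HeightOneSpectrum (𝓞 K)) (hv : (p : 𝓞 K) ∈ v.asIdeal)
    (D : SignedSelmerDualData W κ γ ε)
    (j : (↥(⨆ n, signedLocalPoints κ (v.adicCompletion K) W ε n) →+ ℤ_[p]) →+ D.X)
    (hj : ∀ (φA : ↥(⨆ n, signedLocalPoints κ (v.adicCompletion K) W ε n) →+ ℤ_[p])
        (s : W.subgroupH1 p κ.kerSubgroup) (hs : s ∈ signedSelmerInfty W κ ε)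
        (φ : contOneCocycles (discreteTopRep κ.kerSubgroup (W.geomPrimaryTorsion p)))
        (Q : localPoints W (v.adicCompletion K)) (k : ℕ)
        (_ : oneCocycleClass _ φ = s) (hQ : p ^ k • Q ∈ (⨆ n, signedLocalPoints κ (v.adicCompletion K) W ε n))
        (_ : ∀ τ : localSubgroupOfEmb κ.kerSubgroup (closureEmb (K := K) (v.adicCompletion K)),
          pointsMapOfEmb W (closureEmb (K := K) (v.adicCompletion K))
              ((φ.1 (resGalSubgroupOfEmb κ.kerSubgroup _ τ) : W.geomPrimaryTorsion p) : W.geomPoints) =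
            (τ : absoluteGaloisGroup (v.adicCompletion K)) • Q - Q),
        D.toDual (j φA) ⟨s, hs⟩ =
          (PadicInt.toZModPow k (φA ⟨p ^ k • Q, hQ⟩)).val • ((((p : ℚ) ^ k)⁻¹ : ℚ) : AddCircle (1 : ℚ)))
    (x : D.X)
    (hx : ∀ (s : W.subgroupH1 p κ.kerSubgroup) (hs : s ∈ signedSelmerInfty W κ ε),
      Literature.NumberTheory.EllipticCurves.resOfLe (W.geomPrimaryTorsion p)
        (inf_le_left : κ.kerSubgroup ⊓ decomp v ≤ κ.kerSubgroup) s = 0 → D.toDual x ⟨s, hs⟩ = 0) :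
    ∃ z : localTowerPointsOfEmb κ (closureEmb (K := K) (v.adicCompletion K)) W →+ ℤ_[p],
      j (z.comp (AddSubgroup.inclusion (iSup_signedLocalPoints_le_localTowerPointsOfEmb W p κ ε v))) = x := by
  obtain ⟨z, hz⟩ := exists_functional_of_localCover W p κ ε v D x hx
  refine ⟨z, D.bijective.1 ?_⟩
  ext ⟨s, hs⟩
  have hs' : s ∈ localKummerOverOfEmb W p κ.kerSubgroup (closureEmb (K := K) (v.adicCompletion K))
      (⨆ n, signedLocalPoints κ (v.adicCompletion K) W ε n) :=
    SignedEC.signedSelmerInfty_le_localKummerOverOfEmb_iSup_signedLocalPoints W κ ε v hv hs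
  obtain ⟨φ, Q, k, hφ, hQ, hτ⟩ := (mem_localKummerOverOfEmb_iff _ s).1 hs'
  rw [hj _ s hs φ Q k hφ hQ hτ, hz s hs φ Q k hφ hQ hτ]
  rfl

end Cover

/-! ## §2 `p = 2` on K3's habitat -/

section Two

variable (W : WeierstrassCurve ℚ) [W.IsElliptic] (κ : ZpExtension ℚ 2) {γ : absoluteGaloisGroup ℚ} (ε : ℤˣ)

/-- **(LocCover) of `stub_localRobustPackageTwo` in the points model, `p = 2`, any `W/ℚ`, any sign, any pinned `D`, exponent `m = 0`**:
with the points-model `j` of `KummerPoint.exists_pointsModelJ_two` (or any `j` with its value formula), every `x ∈ X^ε` whose character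
kills the classes of `Sel^ε(E/ℚ_∞)` locally trivial at the prime of `ℚ_∞` above `2` lies in `range j`. (No (NT) / `GoodSS` hypothesis is
needed for this direction.) [cite: Kobayashi2003, (7.17) (p. 12)] -/
theorem exists_pointsModelJ_comp_eq_of_localCover_two (v : HeightOneSpectrum (𝓞 ℚ)) (hv : (2 : 𝓞 ℚ) ∈ v.asIdeal)
    (D : SignedSelmerDualData W κ γ ε)
    (j : (↥(⨆ n, signedLocalPoints κ (v.adicCompletion ℚ) W ε n) →+ ℤ_[2]) →+ D.X)
    (hj : ∀ (φA : ↥(⨆ n, signedLocalPoints κ (v.adicCompletion ℚ) W ε n) →+ ℤ_[2])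
        (s : W.subgroupH1 2 κ.kerSubgroup) (hs : s ∈ signedSelmerInfty W κ ε)
        (φ : contOneCocycles (discreteTopRep κ.kerSubgroup (W.geomPrimaryTorsion 2)))
        (Q : localPoints W (v.adicCompletion ℚ)) (k : ℕ)
        (_ : oneCocycleClass _ φ = s) (hQ : 2 ^ k • Q ∈ (⨆ n, signedLocalPoints κ (v.adicCompletion ℚ) W ε n))
        (_ : ∀ τ : localSubgroupOfEmb κ.kerSubgroup (closureEmb (K := ℚ) (v.adicCompletion ℚ)),
          pointsMapOfEmb W (closureEmb (K := ℚ) (v.adicCompletion ℚ))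
              ((φ.1 (resGalSubgroupOfEmb κ.kerSubgroup _ τ) : W.geomPrimaryTorsion 2) : W.geomPoints) =
            (τ : absoluteGaloisGroup (v.adicCompletion ℚ)) • Q - Q),
        D.toDual (j φA) ⟨s, hs⟩ =
          (PadicInt.toZModPow k (φA ⟨2 ^ k • Q, hQ⟩)).val • ((((2 : ℚ) ^ k)⁻¹ : ℚ) : AddCircle (1 : ℚ)))
    (x : D.X)
    (hx : ∀ (s : W.subgroupH1 2 κ.kerSubgroup) (hs : s ∈ signedSelmerInfty W κ ε),
      Literature.NumberTheory.EllipticCurves.resOfLe (W.geomPrimaryTorsion 2)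
        (inf_le_left : κ.kerSubgroup ⊓ decomp v ≤ κ.kerSubgroup) s = 0 → D.toDual x ⟨s, hs⟩ = 0) :
    ∃ z : localTowerPointsOfEmb κ (closureEmb (K := ℚ) (v.adicCompletion ℚ)) W →+ ℤ_[2],
      j (z.comp (AddSubgroup.inclusion (iSup_signedLocalPoints_le_localTowerPointsOfEmb W 2 κ ε v))) = x := by
  have h := exists_pointsModelJ_comp_eq_of_localCover W 2 κ ε v (by exact_mod_cast hv) D j
    (fun φA s hs φ Q k hφ hQ hτ ↦ by simpa using hj φA s hs φ Q k hφ (by simpa using hQ) hτ) x hx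
  exact h

end Two

end SignedKatoOffTwo.KummerPoint

end Summit.BirchSwinnertonDyer.BirchSwinnertonDyer.Theorems

end
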